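import Summits.BirchSwinnertonDyer.Rank1Residual.X11a.Cells
import Summits.BirchSwinnertonDyer.Rank1Residual.X11a.MainConjectureCertificates
import Literature.NumberTheory.EllipticCurves.Rank1Residual.X9NoEntry
import HarnessLib

/-!
# Class X11a: the leaf's typed input is EXACT on its surjective part, the semistable leaf is
# surjective, and the class statement of record in its final shape
# (cell `b2b-bsdres`, unit `b2b-bsdres-x11a`, gen 13)

HONEST FRAMING (run/shared/lean/b2b/bsd-rank1-residual/, verbatim in every file): the goal of the
cell is to DELETE the COMBINATION-SHAPED residual classes of the Birch–Swinnerton-Dyer formula for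
ALL analytic-rank `≤ 1` elliptic curves over `ℚ` — "full BSD formula for every rank `≤ 1` curve in
class `C`" assembled STRICTLY from published theorems — so that the rank-`≤ 1` remainder becomes
exactly the CONSTRUCTION-SHAPED classes, which are TYPED (missing-input `Prop`s), NOT attempted.
This is not "finishing BSD". Research routes; NO CLAIM BEYOND STATED CLASSES. Theorems only (no
definition, no named fact); assembly of `X11a/Cells.lean` (statement of record `X11a.Target`,
sub-cells `CellThree` / `CellPub` / `Leaf`, typed input of the leaf = `X2.MazurMainConjectureAt`)
with `X11a/MainConjecture.lean` + `X11a/MainConjectureCertificates.lean` (at a multiplicative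
`p ≥ 5` with surjective `ρ̄_{E,p}` and `r_an = 0`: `BSD(E,p) ⟺` Mazur's main conjecture at `(E,p)`).

* `Leaf.mazurMainConjectureAt_iff_bsdp` — on the SURJECTIVE part of the leaf the typed input is
  EXACT (necessary and sufficient); `CellPub.mazurMainConjectureAt` — on the published sub-cell the
  main conjecture at the pair is a THEOREM of the published record (Wuthrich Prop. 21 + the
  converse chain), although Skinner 2016 Thm. A does not apply there (no (ram) prime).
* `Leaf.surj_of_semistable` — a SEMISTABLE curve's leaf pairs have surjective `ρ̄_{E,p}` (Serre 1972
  §5.4 Prop. 21 i) = Edixhoven 1997 Prop. 2.1, PROVED in the tree: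
  `Rank1Residual.surj_of_irr_of_semistable`), so for semistable curves the whole leaf is exact
  (`Leaf.mazurMainConjectureAt_iff_bsdp_of_semistable`) and the non-surjective sub-leaf consists of
  NON-semistable curves only (`Leaf.not_semistable_of_not_surj`; no census pair).
* `targetLeaf_iff_of_published` — the leaf target ⟺ [Mazur's main conjecture at every surjective
  leaf pair] ∧ [`BSD(E,p)` at every non-surjective leaf pair]; with `X11a/Cells.lean`'s
  `target_iff_targetThree_and_targetLeaf` this is the final shape of the class statement of record:
  `Target ⟺ TargetThree ∧ (∀ surjective leaf, main conjecture) ∧ (∀ non-surjective leaf, BSDp)`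
  (`target_iff_final`), every conjunct class-level OPEN, every census pair of the middle conjunct
  closed per pair (REPORT-g9/g12), the last conjunct without a census pair.

Binders (PUBLISHED named facts, as in the companion files): `hKato` (Kato's divisibility for
surjective image at `p ‖ N`, Wuthrich 2014 Thm. 3 / Cor. 19, flag `Wu14-surj-attribution`), `hWu`
(Wuthrich 2014 Prop. 21), `hJs`/`hJn` + `hHs`/`hHn` (Stein–Wuthrich 2013 Thm. 6.1 + §4.2 heights),
`hGS` (Greenberg–Stevens), `hGZK`, `hmod`, `hpar` (GZK, modularity).

References: [Serre1972] §5.4 Prop. 21; [Edixhoven1997] Prop. 2.1; [GreenbergLNM1716] §4–5;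
[Wuthrich2014] Thm. 3, Cor. 19, Prop. 21; [SteinWuthrich2013] Thm. 6.1; [Skinner2016PacificMC]
Thm. A, C; [Miller2011LMS] Def. 1.1.
-/

set_option autoImplicit false

noncomputable section

open scoped Classical MatrixGroups ModularForm

open CongruenceSubgroup WeierstrassCurve Literature.NumberTheory.EllipticCurves
  Literature.NumberTheory.EllipticCurves.ModularForms
  Literature.NumberTheory.EllipticCurves.Rank1Residual
  Literature.NumberTheory.EllipticCurves.Rank1Residual.Typed
  Literature.NumberTheory.EllipticCurves.Wuthrich2014
  Literature.NumberTheory.EllipticCurves.SteinWuthrich2013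

namespace Summit.BirchSwinnertonDyer.Rank1Residual.X11a

variable {W : WeierstrassCurve ℚ} [W.IsElliptic] [W.IsGloballyMinimal] {p : ℕ} [Fact p.Prime]

/-! ### The semistable leaf is surjective -/

/-- **A leaf pair of a SEMISTABLE curve has surjective `ρ̄_{E,p}`** (irreducible ⇒ surjective for
semistable `E/ℚ`, every `p`: Serre 1972 §5.4 Prop. 21 i) / Edixhoven 1997 Prop. 2.1 — PROVED in the
tree, `Rank1Residual.surj_of_irr_of_semistable`). [cite: Serre1972, §5.4 Prop. 21 i)]
[cite: Edixhoven1997, Prop. 2.1 (PDF p. 285)] -/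
theorem Leaf.surj_of_semistable (h : Leaf W p) (hsst : Semistable W) : Surj W p :=
  surj_of_irr_of_semistable W p h.1.irr hsst

/-- Hence a NON-surjective leaf pair belongs to a non-semistable curve (some prime of additive
reduction); in particular on a semistable leaf pair `p ∣ #Ш(E/ℚ)_an`. [cite: Serre1972, §5.4 Prop. 21 i)] -/
theorem Leaf.not_semistable_of_not_surj (h : Leaf W p) (hns : ¬ Surj W p) : ¬ Semistable W :=
  fun hsst => hns (h.surj_of_semistable hsst)

/-- On a semistable leaf pair `#Ш(E/ℚ)_an` is NOT a rational `p`-adic unit (`p ∣ #Ш_an`).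
[cite: Serre1972, §5.4 Prop. 21 i)] -/
theorem Leaf.not_shaAnUnit_of_semistable (h : Leaf W p) (hsst : Semistable W) : ¬ ShaAnUnit W p :=
  h.not_shaAnUnit_of_surj (h.surj_of_semistable hsst)

/-! ### The typed input is exact on the surjective leaf; the published sub-cell proves it -/

/-- **On the surjective part of the leaf the typed missing input is EXACT**: at a leaf pair with
`ρ̄_{E,p}` surjective, `X2.MazurMainConjectureAt W p ↔ BSDp W p` (companion
`mazurMainConjectureAt_iff_bsdp`). [cite: GreenbergLNM1716, §4 (PDF pp. 112–113) and §5 (closing examples)]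
[cite: Wuthrich2014, Thm. 3 (p. 382) and Cor. 19 proof (p. 399)] -/
theorem Leaf.mazurMainConjectureAt_iff_bsdp
    (hKato : kato_charIdeal_dvd_multiplicative_of_surjective)
    (hJs : thm61_splitMultiplicative) (hJn : thm61_nonsplitMultiplicative)
    (hHs : exists_isSplitMultCanonical) (hHn : exists_isMultCanonical)
    (hGZK : rank_eq_analyticRank_of_analyticRank_le_one) (hmod : hasEntireLFunction_rat)
    (hpar : nonempty_modularParametrizationData)
    (hGS : greenberg_stevens (W := W) (p := p)) (h : Leaf W p) (hsurj : Surj W p) :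
    X2.MazurMainConjectureAt W p ↔ BSDp W p :=
  X11a.mazurMainConjectureAt_iff_bsdp hKato hJs hJn hHs hHn hGZK hmod hpar W p hGS h.five_le
    h.1.mult hsurj h.1.1

/-- **For a SEMISTABLE curve the whole leaf is exact** (surjectivity from Serre/Edixhoven).
[cite: Serre1972, §5.4 Prop. 21 i)] [cite: GreenbergLNM1716, §4 (PDF pp. 112–113) and §5 (closing examples)] -/
theorem Leaf.mazurMainConjectureAt_iff_bsdp_of_semistable
    (hKato : kato_charIdeal_dvd_multiplicative_of_surjective)
    (hJs : thm61_splitMultiplicative) (hJn : thm61_nonsplitMultiplicative)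
    (hHs : exists_isSplitMultCanonical) (hHn : exists_isMultCanonical)
    (hGZK : rank_eq_analyticRank_of_analyticRank_le_one) (hmod : hasEntireLFunction_rat)
    (hpar : nonempty_modularParametrizationData)
    (hGS : greenberg_stevens (W := W) (p := p)) (h : Leaf W p) (hsst : Semistable W) :
    X2.MazurMainConjectureAt W p ↔ BSDp W p :=
  h.mazurMainConjectureAt_iff_bsdp hKato hJs hJn hHs hHn hGZK hmod hpar hGS (h.surj_of_semistable hsst)

/-- **On the PUBLISHED sub-cell Mazur's main conjecture at `(E,p)` is a theorem of the published
record** (Wuthrich Prop. 21 `hWu` ⇒ `BSD(E,p)` ⇒ main conjecture by the converse chain), with NO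
(ram) prime — i.e. outside Skinner 2016 Thm. A. Census: 613 of 615 rank-`0` X11-type pairs at
`p ≥ 5`, `N < 2·10⁴`. [cite: Wuthrich2014, Prop. 21 (p. 400)]
[cite: GreenbergLNM1716, §4 (PDF pp. 112–113) and §5 (closing examples)] -/
theorem CellPub.mazurMainConjectureAt
    (hKato : kato_charIdeal_dvd_multiplicative_of_surjective) (hWu : sha_dvd_analyticSha)
    (hJs : thm61_splitMultiplicative) (hJn : thm61_nonsplitMultiplicative)
    (hHs : exists_isSplitMultCanonical) (hHn : exists_isMultCanonical)
    (hGZK : rank_eq_analyticRank_of_analyticRank_le_one) (hmod : hasEntireLFunction_rat)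
    (hGS : greenberg_stevens (W := W) (p := p)) (h : CellPub W p) : X2.MazurMainConjectureAt W p :=
  mazurMainConjectureAt_of_shaAn_unit hKato hWu hJs hJn hHs hHn hGZK hmod W p hGS h.2.1 h.1.mult
    h.2.2.1 h.1.1 h.2.2.2

/-! ### The leaf target and the class statement of record, final shape -/

/-- **The leaf target ⟺ [main conjecture at every SURJECTIVE leaf pair] ∧ [`BSD(E,p)` at every
NON-surjective leaf pair]** (published facts as binders). The first conjunct is X11a's located
gap in its exact form (nothing in print at a très-ramifié (ram)-free `p ‖ N` with `p ∣ #Ш_an`; every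
census pair closed per pair); the second has no census pair (and no semistable member).
[cite: GreenbergLNM1716, §4 (PDF pp. 112–113) and §5 (closing examples)]
[cite: Skinner2016PacificMC, Thm. A (§1) (hypothesis (iii) = (ram))] -/
theorem targetLeaf_iff_of_published
    (hKato : kato_charIdeal_dvd_multiplicative_of_surjective)
    (hJs : thm61_splitMultiplicative) (hJn : thm61_nonsplitMultiplicative)
    (hHs : exists_isSplitMultCanonical) (hHn : exists_isMultCanonical)
    (hGZK : rank_eq_analyticRank_of_analyticRank_le_one) (hmod : hasEntireLFunction_rat)
    (hpar : nonempty_modularParametrizationData)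
    (hGS : ∀ (W : WeierstrassCurve ℚ) [W.IsElliptic] [W.IsGloballyMinimal] (p : ℕ) [Fact p.Prime],
      greenberg_stevens (W := W) (p := p)) :
    TargetLeaf ↔
      (∀ (W : WeierstrassCurve ℚ) [W.IsElliptic] [W.IsGloballyMinimal] (p : ℕ) [Fact p.Prime],
        Leaf W p → Surj W p → X2.MazurMainConjectureAt W p) ∧
      (∀ (W : WeierstrassCurve ℚ) [W.IsElliptic] [W.IsGloballyMinimal] (p : ℕ) [Fact p.Prime],
        Leaf W p → ¬ Surj W p → BSDp W p) := by
  constructor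
  · intro hT
    refine ⟨fun W _ _ p _ hL hsurj => ?_, fun W _ _ p _ hL _ => hT W p hL⟩
    exact (hL.mazurMainConjectureAt_iff_bsdp hKato hJs hJn hHs hHn hGZK hmod hpar (hGS W p)
      hsurj).mpr (hT W p hL)
  · rintro ⟨hMC, hNS⟩ W _ _ p _ hL
    by_cases hsurj : Surj W p
    · exact (hL.mazurMainConjectureAt_iff_bsdp hKato hJs hJn hHs hHn hGZK hmod hpar (hGS W p)
        hsurj).mp (hMC W p hL hsurj)
    · exact hNS W p hL hsurj

/-- **The class statement of record for X11a, final shape**: granted the published facts,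
`X11a.Target ⟺ TargetThree ∧ (∀ surjective leaf pair, Mazur's main conjecture at the pair) ∧
(∀ non-surjective leaf pair, BSD(E,p))` — the published sub-cell needs nothing (Wuthrich Prop. 21,
`hWu`). Each conjunct is OPEN at class level; this is the census-free statement of exactly what the
published record leaves of X11a. [cite: Wuthrich2014, Prop. 21 (p. 400)]
[cite: GreenbergLNM1716, §4 (PDF pp. 112–113) and §5 (closing examples)] -/
theorem target_iff_final
    (hKato : kato_charIdeal_dvd_multiplicative_of_surjective) (hWu : sha_dvd_analyticSha)
    (hJs : thm61_splitMultiplicative) (hJn : thm61_nonsplitMultiplicative)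
    (hHs : exists_isSplitMultCanonical) (hHn : exists_isMultCanonical)
    (hGZK : rank_eq_analyticRank_of_analyticRank_le_one) (hmod : hasEntireLFunction_rat)
    (hpar : nonempty_modularParametrizationData)
    (hGS : ∀ (W : WeierstrassCurve ℚ) [W.IsElliptic] [W.IsGloballyMinimal] (p : ℕ) [Fact p.Prime],
      greenberg_stevens (W := W) (p := p)) :
    Target ↔
      TargetThree ∧
      (∀ (W : WeierstrassCurve ℚ) [W.IsElliptic] [W.IsGloballyMinimal] (p : ℕ) [Fact p.Prime],
        Leaf W p → Surj W p → X2.MazurMainConjectureAt W p) ∧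
      (∀ (W : WeierstrassCurve ℚ) [W.IsElliptic] [W.IsGloballyMinimal] (p : ℕ) [Fact p.Prime],
        Leaf W p → ¬ Surj W p → BSDp W p) := by
  rw [target_iff_targetThree_and_targetLeaf hWu hGZK hmod,
    targetLeaf_iff_of_published hKato hJs hJn hHs hHn hGZK hmod hpar hGS]

/-- **For SEMISTABLE curves the X11a statement at `p ≥ 5` IS Mazur's main conjecture on the leaf**:
restricted to semistable `E`, "`BSD(E,p)` at every leaf pair" ⟺ "the main conjecture at every leaf
pair" (no image hypothesis: Serre/Edixhoven). [cite: Serre1972, §5.4 Prop. 21 i)]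
[cite: GreenbergLNM1716, §4 (PDF pp. 112–113) and §5 (closing examples)] -/
theorem forall_semistable_leaf_bsdp_iff_mazurMainConjectureAt
    (hKato : kato_charIdeal_dvd_multiplicative_of_surjective)
    (hJs : thm61_splitMultiplicative) (hJn : thm61_nonsplitMultiplicative)
    (hHs : exists_isSplitMultCanonical) (hHn : exists_isMultCanonical)
    (hGZK : rank_eq_analyticRank_of_analyticRank_le_one) (hmod : hasEntireLFunction_rat)
    (hpar : nonempty_modularParametrizationData)
    (hGS : ∀ (W : WeierstrassCurve ℚ) [W.IsElliptic] [W.IsGloballyMinimal] (p : ℕ) [Fact p.Prime],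
      greenberg_stevens (W := W) (p := p)) :
    (∀ (W : WeierstrassCurve ℚ) [W.IsElliptic] [W.IsGloballyMinimal] (p : ℕ) [Fact p.Prime],
        Semistable W → Leaf W p → BSDp W p) ↔
    (∀ (W : WeierstrassCurve ℚ) [W.IsElliptic] [W.IsGloballyMinimal] (p : ℕ) [Fact p.Prime],
        Semistable W → Leaf W p → X2.MazurMainConjectureAt W p) := by
  constructor
  · intro h W _ _ p _ hsst hL
    exact (hL.mazurMainConjectureAt_iff_bsdp_of_semistable hKato hJs hJn hHs hHn hGZK hmod hpar
      (hGS W p) hsst).mpr (h W p hsst hL)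
  · intro h W _ _ p _ hsst hL
    exact (hL.mazurMainConjectureAt_iff_bsdp_of_semistable hKato hJs hJn hHs hHn hGZK hmod hpar
      (hGS W p) hsst).mp (h W p hsst hL)

end Summit.BirchSwinnertonDyer.Rank1Residual.X11a

end
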